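import Summits.BirchSwinnertonDyer.BirchSwinnertonDyer.Theorems.ClassRecordThreeEulerHalvesAtThreeEichlerShimuraLevelGamma1
import Summits.BirchSwinnertonDyer.BirchSwinnertonDyer.Theorems.ClassRecordThreeEulerHalvesAtThreeEichlerShimuraSurjectiveCongruenceReduction
import HarnessLib

/-!
# Eichler–Shimura surjectivity in weight two for the principal congruence subgroups `Γ(M)`,
# `M ≥ 3`: the named fact `eichlerShimura_weightTwo_rePeriod_surjective_Gamma` PROVED

Helper file (route `ClassRecordThree`, crux `EulerHalvesAtThree`; the residue (ESᶜ-surj-Γ(M)) of the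
Cartan-cover line, typed as the NAMED FACT
`Literature.NumberTheory.Automorphic.eichlerShimura_weightTwo_rePeriod_surjective_Gamma` (defn-ty1 g45)).

From (ESᶜ-surj) for `Γ₁(N)`, `N ≥ 4` (`…EichlerShimuraLevelGamma1.rePeriod_surjective_gamma1`) we get it
for `Γ(M)`, `M ≥ 3`, by pure group theory plus the cell's transport/descent
(`EichlerShimuraCongruence.esSurjPar_conjAct_smul`, `esSurjPar_of_normal_finiteIndex`): with
`α = diag(M, 1)`,

  `Γ(M²) ≤ α Γ₁(M²) α⁻¹ ⊴ Γ(M)` (finite index),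

since `α⁻¹ Γ(M) α = {a ≡ d ≡ 1 (M), c ≡ 0 (M²)} ≤ Γ₀(M²)` normalises `Γ₁(M²)`. Consequences, all PROVED
(no hypotheses): the named fact (`eichlerShimura_weightTwo_rePeriod_surjective_Gamma_holds`), the
surjectivity residue `eichlerShimura_weightTwo_rePeriod_surjective` and the whole real Eichler–Shimura
conjunct `eichlerShimura_weightTwo_rePeriod` of the Cartan-cover print clauses
(`EichlerShimuraCongruence.eichlerShimura_weightTwo_rePeriod_of_surjective_Gamma`, bsd-idea-10 g23).
No summit statement is proved by this file; BSD is proved for no curve.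

## References

* G. Shimura, *Introduction to the arithmetic theory of automorphic functions* (1971), Thm. 8.4
  p. 234, §1.6, Prop. 1.19, §9.2 p. 246.
* F. Diamond, J. Shurman, *A first course in modular forms*, GTM 228 (2005), §1.2, Ex. 1.2.11,
  §1.5 (conjugation by `diag(M, 1)`).
-/

noncomputable section

open scoped MatrixGroups ModularForm Pointwise

open CongruenceSubgroup Matrix.SpecialLinearGroup ConjAct

set_option linter.dupNamespace false

namespace Summit.BirchSwinnertonDyer.BirchSwinnertonDyer.Theorems.EichlerShimuraLevel

open Literature.NumberTheory.Automorphic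
open Summit.BirchSwinnertonDyer.BirchSwinnertonDyer.Theorems.EichlerShimuraCongruence

/-! ### Congruences -/

/-- `(a : ZMod n) = 1 ↔ n ∣ a - 1`. [folklore] -/
theorem intCast_zmod_eq_one_iff_dvd (n : ℕ) (a : ℤ) : (a : ZMod n) = 1 ↔ (n : ℤ) ∣ a - 1 := by
  rw [← ZMod.intCast_zmod_eq_zero_iff_dvd, Int.cast_sub, Int.cast_one, sub_eq_zero]

/-- `Γ₁(N) ⊴ Γ₀(N)`: conjugation by `Γ₀(N)` preserves `Γ₁(N)` (the kernel of `d mod N`).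
[cite: DiamondShurman2005, §1.2 p. 13] -/
theorem conj_mem_Gamma1_of_mem_Gamma0 {N : ℕ} {g t : SL(2, ℤ)} (hg : g ∈ Gamma0 N)
    (ht : t ∈ Gamma1 N) : g * t * g⁻¹ ∈ Gamma1 N := by
  have ht0 : t ∈ Gamma0 N := Gamma1_in_Gamma0 N ht
  have ht' : (⟨t, ht0⟩ : Gamma0 N) ∈ Gamma1' N := by
    rw [Gamma1_to_Gamma0_mem]
    exact (Gamma1_mem N t).mp ht
  have hn : (Gamma1' N).Normal := MonoidHom.normal_ker (Gamma0Map N)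
  have hconj : (⟨g, hg⟩ * ⟨t, ht0⟩ * ⟨g, hg⟩⁻¹ : Gamma0 N) ∈ Gamma1' N :=
    hn.conj_mem ⟨t, ht0⟩ ht' ⟨g, hg⟩
  rw [Gamma1_to_Gamma0_mem] at hconj
  exact (Gamma1_mem N _).mpr hconj

/-! ### `α = diag(M, 1)` and the two integral conjugations -/

section Alpha

variable (M : ℕ)

/-- **`α = diag(M, 1) ∈ GL(2, ℝ)`** (`M ≠ 0`). [cite: DiamondShurman2005, §1.5] -/
def alpha (hM : M ≠ 0) : GL (Fin 2) ℝ :=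
  Matrix.GeneralLinearGroup.mkOfDetNeZero !![(M : ℝ), 0; 0, 1]
    (by rw [Matrix.det_fin_two_of]; simp [hM])

/-- Entries of `α`. [folklore] -/
@[simp] theorem val_alpha (hM : M ≠ 0) :
    ((alpha M hM : GL (Fin 2) ℝ) : Matrix (Fin 2) (Fin 2) ℝ) = !![(M : ℝ), 0; 0, 1] := rfl

/-- `det α = M > 0`. [folklore] -/
theorem det_alpha_pos (hM : M ≠ 0) : 0 < (alpha M hM).det.val := by
  rw [Matrix.GeneralLinearGroup.val_det_apply, val_alpha, Matrix.det_fin_two_of]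
  have : (0 : ℝ) < M := by exact_mod_cast Nat.pos_of_ne_zero hM
  linarith

/-- **`α t α⁻¹` for `M ∣ c(t)`**: the integral matrix `(a, M b; c / M, d)`. [cite: DiamondShurman2005, §1.5] -/
def conjUp (t : SL(2, ℤ)) (h : (M : ℤ) ∣ t 1 0) : SL(2, ℤ) :=
  ⟨!![t 0 0, M * t 0 1; t 1 0 / M, t 1 1], by
    have hdet := t.2
    rw [Matrix.det_fin_two] at hdet
    rw [Matrix.det_fin_two_of]
    have hc : t 1 0 / M * M = t 1 0 := Int.ediv_mul_cancel h
    linear_combination hdet - (t 0 1) * hc⟩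

/-- Entries of `conjUp`. [folklore] -/
@[simp] theorem coe_conjUp (t : SL(2, ℤ)) (h : (M : ℤ) ∣ t 1 0) :
    ((conjUp M t h : SL(2, ℤ)) : Matrix (Fin 2) (Fin 2) ℤ) = !![t 0 0, M * t 0 1; t 1 0 / M, t 1 1] :=
  rfl

/-- **`α⁻¹ s α` for `M ∣ b(s)`**: the integral matrix `(a, b / M; M c, d)`. [cite: DiamondShurman2005, §1.5] -/
def conjDown (s : SL(2, ℤ)) (h : (M : ℤ) ∣ s 0 1) : SL(2, ℤ) :=
  ⟨!![s 0 0, s 0 1 / M; M * s 1 0, s 1 1], by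
    have hdet := s.2
    rw [Matrix.det_fin_two] at hdet
    rw [Matrix.det_fin_two_of]
    have hb : s 0 1 / M * M = s 0 1 := Int.ediv_mul_cancel h
    linear_combination hdet - (s 1 0) * hb⟩

/-- Entries of `conjDown`. [folklore] -/
@[simp] theorem coe_conjDown (s : SL(2, ℤ)) (h : (M : ℤ) ∣ s 0 1) :
    ((conjDown M s h : SL(2, ℤ)) : Matrix (Fin 2) (Fin 2) ℤ) =
      !![s 0 0, s 0 1 / M; M * s 1 0, s 1 1] :=
  rfl

/-- Entries of `mapGL`. [folklore] -/
theorem val_mapGL_apply (γ : SL(2, ℤ)) (i j : Fin 2) :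
    ((Matrix.SpecialLinearGroup.mapGL ℝ γ : GL (Fin 2) ℝ) : Matrix (Fin 2) (Fin 2) ℝ) i j =
      ((γ i j : ℤ) : ℝ) := by
  rw [val_mapGL_eq_map, Matrix.map_apply]

/-- **`ι(conjUp t) = α ι(t) α⁻¹` in `GL(2, ℝ)`.** [cite: DiamondShurman2005, §1.5] -/
theorem mapGL_conjUp (hM : M ≠ 0) (t : SL(2, ℤ)) (h : (M : ℤ) ∣ t 1 0) :
    Matrix.SpecialLinearGroup.mapGL ℝ (conjUp M t h) =
      alpha M hM * Matrix.SpecialLinearGroup.mapGL ℝ t * (alpha M hM)⁻¹ := by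
  rw [eq_mul_inv_iff_mul_eq]
  apply Units.ext
  rw [Units.val_mul, Units.val_mul]
  have hc : ((t 1 0 / M : ℤ) : ℝ) * M = ((t 1 0 : ℤ) : ℝ) := by
    exact_mod_cast Int.ediv_mul_cancel h
  ext i j
  fin_cases i <;> fin_cases j <;>
    simp [Matrix.mul_apply, Fin.sum_univ_two, hc, mul_comm]

/-- **`ι(conjDown s) = α⁻¹ ι(s) α` in `GL(2, ℝ)`.** [cite: DiamondShurman2005, §1.5] -/
theorem mapGL_conjDown (hM : M ≠ 0) (s : SL(2, ℤ)) (h : (M : ℤ) ∣ s 0 1) :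
    Matrix.SpecialLinearGroup.mapGL ℝ (conjDown M s h) =
      (alpha M hM)⁻¹ * Matrix.SpecialLinearGroup.mapGL ℝ s * alpha M hM := by
  rw [mul_assoc, eq_inv_mul_iff_mul_eq]
  apply Units.ext
  rw [Units.val_mul, Units.val_mul]
  have hb : (M : ℝ) * ((s 0 1 / M : ℤ) : ℝ) = ((s 0 1 : ℤ) : ℝ) := by
    rw [mul_comm]
    exact_mod_cast Int.ediv_mul_cancel h
  ext i j
  fin_cases i <;> fin_cases j <;>
    simp [Matrix.mul_apply, Fin.sum_univ_two, hb, mul_comm]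

/-! ### Memberships -/

/-- `t ∈ Γ₁(M²) ⇒ M ∣ c(t)`. [folklore] -/
theorem dvd_of_mem_Gamma1_sq {t : SL(2, ℤ)} (ht : t ∈ Gamma1 (M ^ 2)) : (M : ℤ) ∣ t 1 0 := by
  have h := ((Gamma1_mem (M ^ 2) t).mp ht).2.2
  rw [ZMod.intCast_zmod_eq_zero_iff_dvd] at h
  exact (Dvd.intro_left _ (by push_cast; ring)).trans h

/-- `t ∈ Γ₁(M²) ⇒ α t α⁻¹ ∈ Γ(M)`. [cite: DiamondShurman2005, §1.5, Ex. 1.2.11] -/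
theorem conjUp_mem_Gamma {t : SL(2, ℤ)} (ht : t ∈ Gamma1 (M ^ 2)) :
    conjUp M t (dvd_of_mem_Gamma1_sq M ht) ∈ Gamma M := by
  obtain ⟨ha, hd, hc⟩ := (Gamma1_mem (M ^ 2) t).mp ht
  rw [intCast_zmod_eq_one_iff_dvd] at ha hd
  rw [ZMod.intCast_zmod_eq_zero_iff_dvd] at hc
  push_cast at ha hd hc
  have hMM : (M : ℤ) ∣ (M : ℤ) ^ 2 := Dvd.intro_left _ (by ring)
  rw [Gamma_mem]
  simp only [coe_conjUp, Matrix.of_apply, Matrix.cons_val', Matrix.cons_val_zero,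
    Matrix.cons_val_one, Matrix.empty_val', Matrix.cons_val_fin_one]
  refine ⟨?_, ?_, ?_, ?_⟩
  · rw [intCast_zmod_eq_one_iff_dvd]; exact hMM.trans ha
  · rw [ZMod.intCast_zmod_eq_zero_iff_dvd]; exact Dvd.intro _ rfl
  · rw [ZMod.intCast_zmod_eq_zero_iff_dvd]
    obtain ⟨k, hk⟩ := hc
    by_cases hM : (M : ℤ) = 0
    · simp [hM]
    · refine ⟨k, ?_⟩
      rw [hk, pow_two, mul_assoc, Int.mul_ediv_cancel_left _ hM]
  · rw [intCast_zmod_eq_one_iff_dvd]; exact hMM.trans hd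

/-- `s ∈ Γ(M) ⇒ M ∣ b(s)`. [folklore] -/
theorem dvd_of_mem_Gamma {s : SL(2, ℤ)} (hs : s ∈ Gamma M) : (M : ℤ) ∣ s 0 1 := by
  have h := (Gamma_mem.mp hs).2.1
  rwa [ZMod.intCast_zmod_eq_zero_iff_dvd] at h

/-- `s ∈ Γ(M) ⇒ α⁻¹ s α ∈ Γ₀(M²)`. [cite: DiamondShurman2005, §1.5] -/
theorem conjDown_mem_Gamma0 {s : SL(2, ℤ)} (hs : s ∈ Gamma M) :
    conjDown M s (dvd_of_mem_Gamma M hs) ∈ Gamma0 (M ^ 2) := by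
  have hc := (Gamma_mem.mp hs).2.2.1
  rw [ZMod.intCast_zmod_eq_zero_iff_dvd] at hc
  rw [Gamma0_mem]
  simp only [coe_conjDown, Matrix.of_apply, Matrix.cons_val', Matrix.cons_val_zero,
    Matrix.cons_val_one, Matrix.empty_val', Matrix.cons_val_fin_one]
  rw [ZMod.intCast_zmod_eq_zero_iff_dvd]
  push_cast
  rw [pow_two]
  exact mul_dvd_mul_left _ hc

/-- `s ∈ Γ(M²) ⇒ M ∣ b(s)`. [folklore] -/
theorem dvd_of_mem_Gamma_sq {s : SL(2, ℤ)} (hs : s ∈ Gamma (M ^ 2)) : (M : ℤ) ∣ s 0 1 :=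
  (Dvd.intro_left _ (by push_cast; ring)).trans (dvd_of_mem_Gamma (M ^ 2) hs)

/-- `s ∈ Γ(M²) ⇒ α⁻¹ s α ∈ Γ₁(M²)`. [cite: DiamondShurman2005, §1.5] -/
theorem conjDown_mem_Gamma1 {s : SL(2, ℤ)} (hs : s ∈ Gamma (M ^ 2)) :
    conjDown M s (dvd_of_mem_Gamma_sq M hs) ∈ Gamma1 (M ^ 2) := by
  obtain ⟨ha, -, hc, hd⟩ := Gamma_mem.mp hs
  rw [ZMod.intCast_zmod_eq_zero_iff_dvd] at hc
  rw [Gamma1_mem]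
  simp only [coe_conjDown, Matrix.of_apply, Matrix.cons_val', Matrix.cons_val_zero,
    Matrix.cons_val_one, Matrix.empty_val', Matrix.cons_val_fin_one]
  refine ⟨ha, hd, ?_⟩
  rw [ZMod.intCast_zmod_eq_zero_iff_dvd]
  push_cast
  exact hc.mul_left _

end Alpha

/-! ### `Γ(M²) ≤ α Γ₁(M²) α⁻¹ ⊴ Γ(M)` of finite index, in `GL(2, ℝ)` -/

section Sandwich

variable (M : ℕ) (hM : M ≠ 0)

/-- `α Γ₁(M²) α⁻¹ ≤ Γ(M)`. [cite: DiamondShurman2005, §1.5, Ex. 1.2.11] -/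
theorem conj_gamma1_le_Gamma :
    toConjAct (alpha M hM) • (Gamma1 (M ^ 2)).map (Matrix.SpecialLinearGroup.mapGL ℝ) ≤
      (Gamma M).map (Matrix.SpecialLinearGroup.mapGL ℝ) := by
  intro δ hδ
  obtain ⟨y, hy, rfl⟩ := exists_eq_conj_of_mem_conjAct_smul hδ
  obtain ⟨t, ht, rfl⟩ := Subgroup.mem_map.mp hy
  rw [← mapGL_conjUp M hM t (dvd_of_mem_Gamma1_sq M ht)]
  exact Subgroup.mem_map_of_mem _ (conjUp_mem_Gamma M ht)

/-- `Γ(M²) ≤ α Γ₁(M²) α⁻¹`. [cite: DiamondShurman2005, §1.5] -/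
theorem Gamma_sq_le_conj_gamma1 :
    (Gamma (M ^ 2)).map (Matrix.SpecialLinearGroup.mapGL ℝ) ≤
      toConjAct (alpha M hM) • (Gamma1 (M ^ 2)).map (Matrix.SpecialLinearGroup.mapGL ℝ) := by
  intro y hy
  obtain ⟨s, hs, rfl⟩ := Subgroup.mem_map.mp hy
  have e : Matrix.SpecialLinearGroup.mapGL ℝ s = alpha M hM *
      Matrix.SpecialLinearGroup.mapGL ℝ (conjDown M s (dvd_of_mem_Gamma_sq M hs)) *
        (alpha M hM)⁻¹ := by
    rw [mapGL_conjDown M hM]; group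
  rw [e]
  exact conj_mem_conjAct_smul _ (Subgroup.mem_map_of_mem _ (conjDown_mem_Gamma1 M hs))

/-- `α Γ₁(M²) α⁻¹` is normal in `Γ(M)`. [cite: DiamondShurman2005, §1.5, §1.2] -/
theorem conj_gamma1_normal :
    ((toConjAct (alpha M hM) • (Gamma1 (M ^ 2)).map (Matrix.SpecialLinearGroup.mapGL ℝ)).subgroupOf
      ((Gamma M).map (Matrix.SpecialLinearGroup.mapGL ℝ))).Normal := by
  refine ⟨fun δ hδ γ₀ => ?_⟩
  rw [Subgroup.mem_subgroupOf] at hδ ⊢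
  obtain ⟨y, hy, hyδ⟩ := exists_eq_conj_of_mem_conjAct_smul hδ
  obtain ⟨t, ht, rfl⟩ := Subgroup.mem_map.mp hy
  obtain ⟨s, hs, hsγ⟩ := Subgroup.mem_map.mp γ₀.2
  set s' := conjDown M s (dvd_of_mem_Gamma M hs) with hs'def
  have hmem : s' * t * s'⁻¹ ∈ Gamma1 (M ^ 2) :=
    conj_mem_Gamma1_of_mem_Gamma0 (conjDown_mem_Gamma0 M hs) ht
  have key : ((γ₀ * δ * γ₀⁻¹ : ↥((Gamma M).map (Matrix.SpecialLinearGroup.mapGL ℝ))) :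
      GL (Fin 2) ℝ) = alpha M hM * Matrix.SpecialLinearGroup.mapGL ℝ (s' * t * s'⁻¹) *
        (alpha M hM)⁻¹ := by
    rw [Subgroup.coe_mul, Subgroup.coe_mul, Subgroup.coe_inv, hyδ, ← hsγ, map_mul, map_mul,
      map_inv, hs'def, mapGL_conjDown M hM]
    group
  rw [key]
  exact conj_mem_conjAct_smul _ (Subgroup.mem_map_of_mem _ hmem)

/-- `α Γ₁(M²) α⁻¹` has finite index in `Γ(M)` (it contains `Γ(M²)`). [cite: DiamondShurman2005, §1.2, §1.5] -/
theorem conj_gamma1_finiteIndex :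
    ((toConjAct (alpha M hM) • (Gamma1 (M ^ 2)).map (Matrix.SpecialLinearGroup.mapGL ℝ)).subgroupOf
      ((Gamma M).map (Matrix.SpecialLinearGroup.mapGL ℝ))).FiniteIndex := by
  haveI : NeZero (M ^ 2) := ⟨pow_ne_zero 2 hM⟩
  have h1 : ((Gamma (M ^ 2)).map (Matrix.SpecialLinearGroup.mapGL ℝ)).relIndex
      ((Gamma M).map (Matrix.SpecialLinearGroup.mapGL ℝ)) ≠ 0 := by
    rw [Subgroup.relIndex_map_map_of_injective _ _ Matrix.SpecialLinearGroup.mapGL_injective]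
    intro h0
    have := Subgroup.relIndex_eq_zero_of_le_right (le_top : Gamma M ≤ ⊤) h0
    rw [Subgroup.relIndex_top_right] at this
    exact Subgroup.FiniteIndex.index_ne_zero this
  exact ⟨fun h0 => h1 (Subgroup.relIndex_eq_zero_of_le_left (Gamma_sq_le_conj_gamma1 M hM) h0)⟩

end Sandwich

/-! ### The named fact and its consequences -/

/-- **(ESᶜ-surj) for `Γ(M)`, `M ≥ 3`**: every additive real `u` on `Γ(M) ≤ GL(2, ℝ)` killing the
parabolic elements is `γ ↦ Re ∫_{z₀}^{γ z₀} F` for some `F ∈ S₂(Γ(M))` — transported from `Γ₁(M²)`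
along `α Γ₁(M²) α⁻¹ ⊴ Γ(M)`. [cite: ShimuraIATAF1971, Thm. 8.4 p. 234] -/
theorem rePeriod_surjective_Gamma (M : ℕ) (hM : 3 ≤ M) :
    ∀ (z₀ : UpperHalfPlane) (u : ↥((Gamma M).map (Matrix.SpecialLinearGroup.mapGL ℝ)) → ℝ),
      (∀ γ δ : ↥((Gamma M).map (Matrix.SpecialLinearGroup.mapGL ℝ)), u (γ * δ) = u γ + u δ) →
      (∀ γ : ↥((Gamma M).map (Matrix.SpecialLinearGroup.mapGL ℝ)),
        (γ : GL (Fin 2) ℝ).IsParabolic → u γ = 0) →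
      ∃ F : CuspForm ((Gamma M).map (Matrix.SpecialLinearGroup.mapGL ℝ)) 2,
        ∀ γ : ↥((Gamma M).map (Matrix.SpecialLinearGroup.mapGL ℝ)),
          CuspForm.rePeriod F z₀ γ = u γ := by
  have hM0 : M ≠ 0 := by omega
  haveI : NeZero (M ^ 2) := ⟨pow_ne_zero 2 hM0⟩
  have h4 : 4 ≤ M ^ 2 := by nlinarith
  have hES := esSurjPar_conjAct_smul (Γ := (Gamma1 (M ^ 2)).map (Matrix.SpecialLinearGroup.mapGL ℝ))
    (fun z₀ u hu hpar => rePeriod_surjective_gamma1 (M ^ 2) h4 z₀ u hu hpar) (det_alpha_pos M hM0)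
  exact esSurjPar_of_normal_finiteIndex (conj_gamma1_le_Gamma M hM0) (conj_gamma1_normal M hM0)
    (conj_gamma1_finiteIndex M hM0) hES

/-- **THE NAMED FACT `eichlerShimura_weightTwo_rePeriod_surjective_Gamma` HOLDS** (Shimura Thm. 8.4,
surjectivity, `n = 0`, `Ψ = 1`, for every `Γ(M)`, `M ≥ 3`). [cite: ShimuraIATAF1971, Thm. 8.4 p. 234] -/
theorem eichlerShimura_weightTwo_rePeriod_surjective_Gamma_holds :
    eichlerShimura_weightTwo_rePeriod_surjective_Gamma :=
  fun M hM => rePeriod_surjective_Gamma M hM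

/-- **(ESᶜ-surj) PROVED**: the surjectivity residue of the Cartan-cover line for every order of every
indefinite rational quaternion algebra. [cite: ShimuraIATAF1971, Thm. 8.4 p. 234; §9.2 p. 246] -/
theorem eichlerShimura_weightTwo_rePeriod_surjective_holds :
    eichlerShimura_weightTwo_rePeriod_surjective :=
  eichlerShimura_weightTwo_rePeriod_surjective_of_surjective_Gamma
    eichlerShimura_weightTwo_rePeriod_surjective_Gamma_holds

/-- **(ESᶜ) PROVED**: the whole real Eichler–Shimura conjunct `eichlerShimura_weightTwo_rePeriod` of the
Cartan-cover print clauses (injectivity and surjectivity of the real period map in weight two for the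
norm-one groups of orders in indefinite rational quaternion algebras). [cite: ShimuraIATAF1971, Thm. 8.4 p. 234; §9.2 p. 246] -/
theorem eichlerShimura_weightTwo_rePeriod_holds : eichlerShimura_weightTwo_rePeriod :=
  eichlerShimura_weightTwo_rePeriod_of_surjective_Gamma
    eichlerShimura_weightTwo_rePeriod_surjective_Gamma_holds

end Summit.BirchSwinnertonDyer.BirchSwinnertonDyer.Theorems.EichlerShimuraLevel

end
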